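import Summits.QuantumFields.QCD.Theorems.SpectralDefectExtinctionWindowExtinctionCornerSingleLinkWilsonCircle

/-!
# Single-link resonance (S2c of line `corner-decorrelation-deep-hole`): the plaquette holonomy and its phase
matrix along the one-link circle
(crux `Summit.QuantumFields.QCD.Theses.SpectralDefectExtinction.WindowExtinction`, item stmt-QuantumFields-18063)

Brick D′ of the registered stub `stub_singleLinkResonance`.  On the four-torus of side `L ≥ 2`, the
`(0,1)`-plaquette at `z` reads the link `e = (z, 0)` exactly once, as its FIRST factor:

* `cornerSL_holonomy_update` — `U_{P₀₁(z)}(U[e ↦ g]) = g · N(U)` with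
  `N(U) = U(z+0̂,1) U(z+1̂,0)⁻¹ U(z,1)⁻¹` independent of `g`;
* `cornerSL_holonomy_circle_matrix` — along a degree-one trigonometric link curve `c`,
  `ρ(U_P(U[e ↦ U(e)c(s)])) = M (δ₀ + cos s δ₁ + sin s δ₂) N` with `M = ρ(U(e))`;
* `cornerSL_phase_circle` — hence the phase matrix `S(U) = (−i/2)(a ρ(U_P) − ā ρ(U_P)ᴴ)` is, along the
  circle, the trigonometric Hermitian family `H₀ + cos s H₁ + sin s H₂` with
  `H_k = (−i/2)(a M δ_k N − ā (M δ_k N)ᴴ)` — the shape consumed by the area bound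
  `cornerSL_trigFamily_areaBound` (brick D) and, at `s = 0` with `δ₂ = X_i`, by the rigidity lemma
  `cornerSL_point_rigidity`;
* `cornerSL_phase_continuous` — `U ↦ S(U)` is continuous.
-/

noncomputable section

namespace Summit.QuantumFields.QCD.Cruxes.WindowExtinction.CornerDecorrelationDeepHole

open scoped BigOperators Matrix ComplexConjugate
open Matrix
open Literature.MathematicalPhysics.QuantumLattice Literature.MathematicalPhysics.QuantumFieldTheory
  Literature.Probability.LatticeModels

/-- **The `(0,1)`-plaquette at `z` reads the link `(z,0)` once, as its first factor** (`L ≥ 2`). -/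
theorem cornerSL_holonomy_update {L : ℕ} (hL : 2 ≤ L) (U : GaugeConfig 4 L SU3) (z : TorusSite 4 L) (g : SU3) :
    plaquetteHolonomy (Function.update U (z, 0) g) z 0 1 =
      g * (U (Site.shift z 0, 1) * (U (Site.shift z 1, 0))⁻¹ * (U (z, 1))⁻¹) := by
  unfold plaquetteHolonomy
  have h10 : (1 : Fin 4) ≠ 0 := by decide
  have h1 : ((Site.shift z 0, (1 : Fin 4)) : Edge 4 L) ≠ (z, 0) := fun h => h10 (congrArg Prod.snd h)
  have h2 : ((Site.shift z 1, (0 : Fin 4)) : Edge 4 L) ≠ (z, 0) := fun h =>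
    cornerSL_shift_ne hL z 1 (congrArg Prod.fst h)
  have h3 : ((z, (1 : Fin 4)) : Edge 4 L) ≠ (z, 0) := fun h => h10 (congrArg Prod.snd h)
  rw [Function.update_self, Function.update_of_ne h1, Function.update_of_ne h2, Function.update_of_ne h3,
    mul_assoc, mul_assoc, mul_assoc]

/-- The `(0,1)`-plaquette at `z` factors through its first link: `U_P = U(z,0) · N(U)`. -/
theorem cornerSL_holonomy_eq {L : ℕ} (hL : 2 ≤ L) (U : GaugeConfig 4 L SU3) (z : TorusSite 4 L) :
    plaquetteHolonomy U z 0 1 = U (z, 0) * (U (Site.shift z 0, 1) * (U (Site.shift z 1, 0))⁻¹ * (U (z, 1))⁻¹) := by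
  have h := cornerSL_holonomy_update hL U z (U (z, 0))
  rwa [Function.update_eq_self] at h

/-- **The plaquette matrix along the one-link circle**: `ρ(U_P(U[e ↦ U(e)c(s)])) = M (δ₀ + cos s δ₁ + sin s δ₂) N`. -/
theorem cornerSL_holonomy_circle_matrix {L : ℕ} (hL : 2 ≤ L) (U : GaugeConfig 4 L SU3) (z : TorusSite 4 L)
    (c : ℝ → SU3) (δ₀ δ₁ δ₂ : Matrix (Fin 3) (Fin 3) ℂ)
    (hc : ∀ t, ((c t : SU3) : Matrix (Fin 3) (Fin 3) ℂ) =
      δ₀ + ((Real.cos t : ℝ) : ℂ) • δ₁ + ((Real.sin t : ℝ) : ℂ) • δ₂) (s : ℝ) :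
    ((plaquetteHolonomy (Function.update U (z, 0) (U (z, 0) * c s)) z 0 1 : SU3) : Matrix (Fin 3) (Fin 3) ℂ) =
      ((U (z, 0) : SU3) : Matrix (Fin 3) (Fin 3) ℂ) * (δ₀ + ((Real.cos s : ℝ) : ℂ) • δ₁ + ((Real.sin s : ℝ) : ℂ) • δ₂) *
        (((U (Site.shift z 0, 1) * (U (Site.shift z 1, 0))⁻¹ * (U (z, 1))⁻¹ : SU3)) : Matrix (Fin 3) (Fin 3) ℂ) := by
  rw [cornerSL_holonomy_update hL, Submonoid.coe_mul, Submonoid.coe_mul, hc]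

/-- Entrywise form of the phase-matrix linearity used below. -/
theorem cornerSL_phase_entry_aux (a I2 x₀ x₁ x₂ y₀ y₁ y₂ : ℂ) (cs sn : ℝ) :
    I2 * (a * (x₀ + (cs : ℂ) * x₁ + (sn : ℂ) * x₂) -
        (starRingEnd ℂ a) * (starRingEnd ℂ) (y₀ + (cs : ℂ) * y₁ + (sn : ℂ) * y₂)) =
      I2 * (a * x₀ - (starRingEnd ℂ a) * (starRingEnd ℂ) y₀) +
        (cs : ℂ) * (I2 * (a * x₁ - (starRingEnd ℂ a) * (starRingEnd ℂ) y₁)) +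
        (sn : ℂ) * (I2 * (a * x₂ - (starRingEnd ℂ a) * (starRingEnd ℂ) y₂)) := by
  simp only [map_add, map_mul, Complex.conj_ofReal]
  ring

/-- **The phase matrix along the one-link circle is a trigonometric Hermitian family**:
`(−i/2)(a ρ(U_P(s)) − ā ρ(U_P(s))ᴴ) = H₀ + cos s H₁ + sin s H₂`, `H_k = (−i/2)(a Mδ_kN − ā (Mδ_kN)ᴴ)`. -/
theorem cornerSL_phase_circle {L : ℕ} (hL : 2 ≤ L) (U : GaugeConfig 4 L SU3) (z : TorusSite 4 L)
    (c : ℝ → SU3) (δ₀ δ₁ δ₂ : Matrix (Fin 3) (Fin 3) ℂ)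
    (hc : ∀ t, ((c t : SU3) : Matrix (Fin 3) (Fin 3) ℂ) =
      δ₀ + ((Real.cos t : ℝ) : ℂ) • δ₁ + ((Real.sin t : ℝ) : ℂ) • δ₂) (a : ℂ) (s : ℝ) :
    (-Complex.I / 2) • (a • ((plaquetteHolonomy (Function.update U (z, 0) (U (z, 0) * c s)) z 0 1 : SU3) :
        Matrix (Fin 3) (Fin 3) ℂ) -
      (starRingEnd ℂ a) • (((plaquetteHolonomy (Function.update U (z, 0) (U (z, 0) * c s)) z 0 1 : SU3) :
        Matrix (Fin 3) (Fin 3) ℂ))ᴴ) =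
    ((-Complex.I / 2) • (a • (((U (z, 0) : SU3) : Matrix (Fin 3) (Fin 3) ℂ) * δ₀ *
        (((U (Site.shift z 0, 1) * (U (Site.shift z 1, 0))⁻¹ * (U (z, 1))⁻¹ : SU3)) : Matrix (Fin 3) (Fin 3) ℂ)) -
      (starRingEnd ℂ a) • (((U (z, 0) : SU3) : Matrix (Fin 3) (Fin 3) ℂ) * δ₀ *
        (((U (Site.shift z 0, 1) * (U (Site.shift z 1, 0))⁻¹ * (U (z, 1))⁻¹ : SU3)) : Matrix (Fin 3) (Fin 3) ℂ))ᴴ)) +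
    ((Real.cos s : ℝ) : ℂ) • ((-Complex.I / 2) • (a • (((U (z, 0) : SU3) : Matrix (Fin 3) (Fin 3) ℂ) * δ₁ *
        (((U (Site.shift z 0, 1) * (U (Site.shift z 1, 0))⁻¹ * (U (z, 1))⁻¹ : SU3)) : Matrix (Fin 3) (Fin 3) ℂ)) -
      (starRingEnd ℂ a) • (((U (z, 0) : SU3) : Matrix (Fin 3) (Fin 3) ℂ) * δ₁ *
        (((U (Site.shift z 0, 1) * (U (Site.shift z 1, 0))⁻¹ * (U (z, 1))⁻¹ : SU3)) : Matrix (Fin 3) (Fin 3) ℂ))ᴴ)) +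
    ((Real.sin s : ℝ) : ℂ) • ((-Complex.I / 2) • (a • (((U (z, 0) : SU3) : Matrix (Fin 3) (Fin 3) ℂ) * δ₂ *
        (((U (Site.shift z 0, 1) * (U (Site.shift z 1, 0))⁻¹ * (U (z, 1))⁻¹ : SU3)) : Matrix (Fin 3) (Fin 3) ℂ)) -
      (starRingEnd ℂ a) • (((U (z, 0) : SU3) : Matrix (Fin 3) (Fin 3) ℂ) * δ₂ *
        (((U (Site.shift z 0, 1) * (U (Site.shift z 1, 0))⁻¹ * (U (z, 1))⁻¹ : SU3)) : Matrix (Fin 3) (Fin 3) ℂ))ᴴ)) := by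
  rw [cornerSL_holonomy_circle_matrix hL U z c δ₀ δ₁ δ₂ hc s]
  set M : Matrix (Fin 3) (Fin 3) ℂ := ((U (z, 0) : SU3) : Matrix (Fin 3) (Fin 3) ℂ)
  set N : Matrix (Fin 3) (Fin 3) ℂ :=
    (((U (Site.shift z 0, 1) * (U (Site.shift z 1, 0))⁻¹ * (U (z, 1))⁻¹ : SU3)) : Matrix (Fin 3) (Fin 3) ℂ)
  have hexp : M * (δ₀ + ((Real.cos s : ℝ) : ℂ) • δ₁ + ((Real.sin s : ℝ) : ℂ) • δ₂) * N =
      M * δ₀ * N + ((Real.cos s : ℝ) : ℂ) • (M * δ₁ * N) + ((Real.sin s : ℝ) : ℂ) • (M * δ₂ * N) := by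
    rw [Matrix.mul_add, Matrix.mul_add, Matrix.add_mul, Matrix.add_mul, Matrix.mul_smul, Matrix.mul_smul,
      Matrix.smul_mul, Matrix.smul_mul]
  rw [hexp]
  ext i j
  simp only [Matrix.add_apply, Matrix.smul_apply, Matrix.sub_apply, Matrix.conjTranspose_apply, smul_eq_mul,
    Complex.star_def]
  exact cornerSL_phase_entry_aux a (-Complex.I / 2) _ _ _ _ _ _ (Real.cos s) (Real.sin s)

/-- The phase matrix of the `(0,1)`-plaquette at `z` is continuous in the gauge field. -/
theorem cornerSL_phase_continuous {L : ℕ} [NeZero L] (z : TorusSite 4 L) (a : ℂ) :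
    Continuous fun U : GaugeConfig 4 L SU3 =>
      (-Complex.I / 2) • (a • ((plaquetteHolonomy U z 0 1 : SU3) : Matrix (Fin 3) (Fin 3) ℂ) -
        (starRingEnd ℂ a) • (((plaquetteHolonomy U z 0 1 : SU3) : Matrix (Fin 3) (Fin 3) ℂ))ᴴ) := by
  have hY : Continuous fun U : GaugeConfig 4 L SU3 =>
      ((plaquetteHolonomy U z 0 1 : SU3) : Matrix (Fin 3) (Fin 3) ℂ) :=
    continuous_subtype_val.comp (by unfold plaquetteHolonomy; fun_prop)
  exact ((hY.const_smul a).sub (hY.matrix_conjTranspose.const_smul (starRingEnd ℂ a))).const_smul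
    (-Complex.I / 2)

end Summit.QuantumFields.QCD.Cruxes.WindowExtinction.CornerDecorrelationDeepHole

end
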